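import Literature.IUT.HodgeArakelov.GaloisPairRigidityGenuine
import Literature.IUT.HodgeArakelov.GaloisPairRigidityRmk1111bGenuine
import Literature.IUT.HodgeArakelov.AbsTopMonoidsGenuineRmk181Holds
import Literature.IUT.HodgeArakelov.AbsTopMonoidsGenuineZHatCompare
import Literature.IUT.HodgeArakelov.TemperedThetaMonoidsSubdagProofs
import HarnessLib

/-!
# [IUTchII] Prop 3.4 (ii), STRONG FORM (over all of `Aut(G)`) — UNCONDITIONAL at the fully genuine producer (proof-only)

S. Mochizuki, *Inter-universal Teichmüller theory II*, §3, Proposition 3.4 (ii), kurims manuscript (Dec. 2020)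
pp. 92–93 [claim: Mochizuki2012, status: disputed] (IUTchII §3 Prop 3.4 (ii), kurims pp.92-93): the Kummer-theoretic
construction «depends on the cyclotomic rigidity isomorphism of Corollary 1.11, (b) …, hence fails to be compatible …
with automorphisms of the pair `G_v ↷ (Ψ_{†C_v})^{×μ}` which arise from automorphisms of the pair `G_v ↷ (Ψ_{†C_v})^×`
[cf. Remarks 1.11.1, (i), (b); 1.8.1]». Record-only vocabulary under the claim key `Mochizuki2012` (D-0012, disputed);
abc-iut cell, layer L6, node IUTchII:Prop3.4(ii) (sub-DAG `plan/L6/SUBDAG-IUTchII-Prop-31-33-34.md`, junction J13,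
STRONG form); seat abc-iut-w5-d084 (gen 9), row «P34II-STRONG-GENUINE» (the sequel named by abc-iut-w6-d010 /
abc-iut-w6-d011). PROOF-ONLY (no `def` / `structure` / `instance`); every input consumed BY NAME.

The tree holds abc-iut-w5-d169's CONDITIONAL closer
`TemperedThetaMonoids.prop34iiUniradialContent_strong_of_rmk1111_rmk181 A zhatPow ha hb h181 G hcompat u hu`
(`TemperedThetaMonoidsSubdagProofs.lean`): over an abstract inhabitant `A : AbsTopMonoids S` of abc-iut-L6-t1's
[AbsTopIII]-output interface, given the named facts `Rmk1111_a A` ([AbsTopIII] Prop. 3.2 (iv)), `Rmk1111_b A zhatPow`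
([AbsTopIII] Prop. 3.3 (ii)), `Rmk181_statement A` (Remark 1.8.1, LCFT), the compatibility `hcompat` of the
`Ẑ^×`-action `zhatPow` on `O^×(G)` with `Ẑ^× → Ism(G) ↷ O^{×μ}(G)`, and one `u ∈ Ẑ^×` acting non-trivially on
`O^{×μ}(G)`, the automorphism `ψ` of the coric pair `G ↷ O^{×μ}(G)` induced by the pair-automorphism `(1, x ↦ x^u)` of
`G ↷ O^×(G)` is induced by NO automorphism of the TM-pair `G ↷ O^⊳(G)` WHATSOEVER — over any `σ ∈ Aut(G)`, not only
over `1` (the weak form / J13 `Prop34iiUniradialContent`, already unconditional at the genuine producers: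
`prop34iiUniradialContent_genuineOfModelIsm`, abc-iut-w6-d010).

At the fully genuine producer `AbsTopMonoids.genuineOfModelIsm S C ε hΔ hq` of [IUTchII] Ex. 1.8 (abc-iut-L6-d2;
`O^⊳(G) = 𝒪_k̄^⊳`, `O^⊳(σ) =` THE equivariant lift, `Ism(G)` = print's isometry group, `Ẑ^× ↠ ℤ_p^× ↪ Ism(G)`) EVERY
hypothesis of that closer is now a theorem of the tree:
* `ha` ← `rmk1111_a_genuineOfModelIsm` (abc-iut-w6-d010, `GaloisPairRigidityGenuine`);
* `zhatPow := fun _ => Genuine.zhatPowOunits C` and `hb` ← `Genuine.rmk1111_b_genuineOfModelIsm` (abc-iut-w6-d010,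
  `AbsTopMonoidsGenuineZHatPow` / `GaloisPairRigidityRmk1111bGenuine`; FACT-LIST F-0418 at the producer);
* `h181` ← `rmk181_genuineOfModelIsm` (abc-iut-L6-d2 + abc-iut-w6-d012, `AbsTopMonoidsGenuineRmk181Holds`; F-0414);
* `hcompat` ← `genuineOfModelIsm_actIsm_toIsm_mk` (abc-iut-L6-d2, `AbsTopMonoidsGenuineZHatCompare`: `toIsm(u)·[x] =
  [x^u]`);
* `hu` ← `actIsm_toIsm_ne_one` at `u := −1` (abc-iut-L6-d2, `AbsTopMonoidsGenuineIsometriesProofs`), or, for a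
  general `γ ∈ Ẑ^×`, `actIsm_toIsm_eq_one_iff` («nontrivial image in `ℤ_p^×`», `AbsTopMonoidsGenuineRmk181`).

This file records the compositions:
* `prop34iiStrong_genuineOfModelIsm_of_ne_one` — the strong form for EVERY `γ ∈ Ẑ^×` acting non-trivially;
* `prop34iiStrong_genuineOfModelIsm_of_padicChar_ne_one` — the same with print's literal side condition
  `χ_p(γ) ≠ 1` («nontrivial image in `ℤ_p^×`»);
* **`prop34iiStrong_genuineOfModelIsm`** — **IUTchII:Prop3.4(ii) STRONG FORM, UNCONDITIONAL** at the fully genuine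
  producer, for every `G` (witness `γ := −1`, acting by inversion); `prop34iiStrong_genuineOfModel` — the same at
  the genuine-mod-`ε` producer `genuineOfModel` (abc-iut-L6-t13), whose pair data are definitionally the same.

HONEST FRAMING: OUR kernel consequences of classical statements ([AbsTopIII] Prop. 3.2 (iv) / 3.3 (ii), local class
field theory, the `p`-adic logarithm — all proved in the tree at this producer); record-anchored to a disputed corpus
through the locators only; nothing here bears on [IUTchIII] Cor. 3.12; typed ≠ proved elsewhere.
-/

set_option autoImplicit false

noncomputable section

namespace Literature.IUT.HodgeArakelov

open CategoryTheory
open Literature.AnabelianGeometry.AbsoluteAnabelian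
open Literature.AnabelianGeometry.EtaleTheta

namespace AbsTopMonoids

open Genuine

variable (S : ThetaSetting.{0}) (C : MLFClosure.{0}) (ε : S.Gk ≃ₜ* (ModelMLFGaloisData.galois C.k C.K).tmPair.Pi)
  (hΔ : ∀ f : S.PiX ≃ₜ* S.PiX, S.DeltaX.map f.toMulEquiv.toMonoidHom = S.DeltaX)
  (hq : Nonempty (TopGroup.quot S.PiX S.DeltaX ≃ₜ* S.Gk))

/-- **IUTchII:Prop3.4(ii), STRONG FORM at the fully genuine producer, for every `γ ∈ Ẑ^×` acting non-trivially on
`O^{×μ}(G)`**: the automorphism `ψ := toIsm(γ)` of `O^{×μ}(G) = (𝒪_k̄^⊳)ˣ⧸μ` commutes with `G`, is induced by the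
pair-automorphism `(1, x ↦ x^γ)` of `G ↷ O^×(G)`, and is induced by NO automorphism `q` of the TM-pair `G ↷ O^⊳(G)`
(over any `σ ∈ Aut(G)`): some unit `x` has `[q(x)] ≠ ψ [x]`. Composition of abc-iut-w5-d169's conditional closer with
the genuine-producer discharges of `Rmk1111_a`, `Rmk1111_b`, `Rmk181_statement` and the `Ẑ^×`/`Ism` compatibility.
[claim: Mochizuki2012, status: disputed] (IUTchII §3 Prop 3.4 (ii), kurims pp.92-93) -/
theorem prop34iiStrong_genuineOfModelIsm_of_ne_one (G : IsoClass S.Gk) (γ : ZHatUnits)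
    (hγ : (genuineOfModelIsm S C ε hΔ hq).actIsm G ((genuineOfModelIsm S C ε hΔ hq).toIsm G γ) ≠ 1) :
    ∃ ψ : MulAut ((genuineOfModelIsm S C ε hΔ hq).Oxmu G),
      (∀ (g : G.G) (x : (genuineOfModelIsm S C ε hΔ hq).Oxmu G),
          ψ ((genuineOfModelIsm S C ε hΔ hq).actOxmu G g x) = (genuineOfModelIsm S C ε hΔ hq).actOxmu G g (ψ x)) ∧
      (∃ p : PairAut G ((genuineOfModelIsm S C ε hΔ hq).Ounits G) ((genuineOfModelIsm S C ε hΔ hq).actOunits G),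
          PairAut.forget p = 1 ∧
          ∀ x : (genuineOfModelIsm S C ε hΔ hq).Ounits G,
            (QuotientGroup.mk (p.1.2 x) : (genuineOfModelIsm S C ε hΔ hq).Oxmu G) = ψ (QuotientGroup.mk x)) ∧
      ∀ q : PairAut G ((genuineOfModelIsm S C ε hΔ hq).Otri G) ((genuineOfModelIsm S C ε hΔ hq).actOtri G),
          ∃ x : (genuineOfModelIsm S C ε hΔ hq).Ounits G,
            (QuotientGroup.mk (Units.map q.1.2.toMonoidHom x) : (genuineOfModelIsm S C ε hΔ hq).Oxmu G) ≠
              ψ (QuotientGroup.mk x) :=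
  TemperedThetaMonoids.prop34iiUniradialContent_strong_of_rmk1111_rmk181 (genuineOfModelIsm S C ε hΔ hq)
    (fun _ => zhatPowOunits C) (rmk1111_a_genuineOfModelIsm S C ε hΔ hq) (rmk1111_b_genuineOfModelIsm C S ε hΔ hq)
    (rmk181_genuineOfModelIsm S C ε hΔ hq) G (fun u x => (genuineOfModelIsm_actIsm_toIsm_mk S C ε hΔ hq G u x).symm)
    γ hγ

/-- **IUTchII:Prop3.4(ii), STRONG FORM at the fully genuine producer, with print's literal side condition** «[a unit
of `Ẑ`] that has nontrivial image in `ℤ_p^×`» (Remark 1.8.1): for every `γ ∈ Ẑ^×` with `χ_p(γ) ≠ 1` the automorphism of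
the coric pair `G ↷ O^{×μ}(G)` induced by `(1, x ↦ x^γ)` is induced by no automorphism of the TM-pair `G ↷ O^⊳(G)`
(abc-iut-L6-d2's `actIsm_toIsm_eq_one_iff`: `toIsm(γ)` acts trivially iff `χ_p(γ) = 1`).
[claim: Mochizuki2012, status: disputed] (IUTchII §3 Prop 3.4 (ii), kurims pp.92-93) -/
theorem prop34iiStrong_genuineOfModelIsm_of_padicChar_ne_one (G : IsoClass S.Gk) (γ : ZHatUnits)
    (hγ : haveI := C.fact_residueChar_prime; ZHatLevel.padicCharUnits C.residueChar γ ≠ 1) :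
    ∃ ψ : MulAut ((genuineOfModelIsm S C ε hΔ hq).Oxmu G),
      (∀ (g : G.G) (x : (genuineOfModelIsm S C ε hΔ hq).Oxmu G),
          ψ ((genuineOfModelIsm S C ε hΔ hq).actOxmu G g x) = (genuineOfModelIsm S C ε hΔ hq).actOxmu G g (ψ x)) ∧
      (∃ p : PairAut G ((genuineOfModelIsm S C ε hΔ hq).Ounits G) ((genuineOfModelIsm S C ε hΔ hq).actOunits G),
          PairAut.forget p = 1 ∧
          ∀ x : (genuineOfModelIsm S C ε hΔ hq).Ounits G,
            (QuotientGroup.mk (p.1.2 x) : (genuineOfModelIsm S C ε hΔ hq).Oxmu G) = ψ (QuotientGroup.mk x)) ∧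
      ∀ q : PairAut G ((genuineOfModelIsm S C ε hΔ hq).Otri G) ((genuineOfModelIsm S C ε hΔ hq).actOtri G),
          ∃ x : (genuineOfModelIsm S C ε hΔ hq).Ounits G,
            (QuotientGroup.mk (Units.map q.1.2.toMonoidHom x) : (genuineOfModelIsm S C ε hΔ hq).Oxmu G) ≠
              ψ (QuotientGroup.mk x) :=
  prop34iiStrong_genuineOfModelIsm_of_ne_one S C ε hΔ hq G γ fun h =>
    hγ ((actIsm_toIsm_eq_one_iff S C ε hΔ hq G γ).1 h)

/-- **IUTchII:Prop3.4(ii), STRONG FORM (over ALL of `Aut(G)`), UNCONDITIONAL at the fully genuine producer**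
`genuineOfModelIsm S C ε hΔ hq`, for every `G`: there is a `G`-equivariant automorphism `ψ` of `O^{×μ}(G)` (namely
INVERSION, the action of `−1 ∈ Ẑ^×` through `Ism(G)`) induced by an automorphism of the pair `G ↷ O^×(G)` over `1` and
induced by NO automorphism of the TM-pair `G ↷ O^⊳(G)` — kurims pp. 92–93 «fails to be compatible … with automorphisms
of the pair `G_v ↷ (Ψ_{†C_v})^{×μ}` which arise from automorphisms of the pair `G_v ↷ (Ψ_{†C_v})^×` [cf. Remarks 1.11.1,
(i), (b); 1.8.1]», with BOTH cited remarks discharged at this producer. No hypothesis beyond the producer's own (H1) `hΔ`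
/ (H2) `hq`. [claim: Mochizuki2012, status: disputed] (IUTchII §3 Prop 3.4 (ii), kurims pp.92-93) -/
theorem prop34iiStrong_genuineOfModelIsm (G : IsoClass S.Gk) :
    ∃ ψ : MulAut ((genuineOfModelIsm S C ε hΔ hq).Oxmu G),
      (∀ (g : G.G) (x : (genuineOfModelIsm S C ε hΔ hq).Oxmu G),
          ψ ((genuineOfModelIsm S C ε hΔ hq).actOxmu G g x) = (genuineOfModelIsm S C ε hΔ hq).actOxmu G g (ψ x)) ∧
      (∃ p : PairAut G ((genuineOfModelIsm S C ε hΔ hq).Ounits G) ((genuineOfModelIsm S C ε hΔ hq).actOunits G),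
          PairAut.forget p = 1 ∧
          ∀ x : (genuineOfModelIsm S C ε hΔ hq).Ounits G,
            (QuotientGroup.mk (p.1.2 x) : (genuineOfModelIsm S C ε hΔ hq).Oxmu G) = ψ (QuotientGroup.mk x)) ∧
      ∀ q : PairAut G ((genuineOfModelIsm S C ε hΔ hq).Otri G) ((genuineOfModelIsm S C ε hΔ hq).actOtri G),
          ∃ x : (genuineOfModelIsm S C ε hΔ hq).Ounits G,
            (QuotientGroup.mk (Units.map q.1.2.toMonoidHom x) : (genuineOfModelIsm S C ε hΔ hq).Oxmu G) ≠
              ψ (QuotientGroup.mk x) :=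
  prop34iiStrong_genuineOfModelIsm_of_ne_one S C ε hΔ hq G ZHatLevel.negOneAut (actIsm_toIsm_ne_one S C ε hΔ hq G)

/-- **IUTchII:Prop3.4(ii), STRONG FORM, UNCONDITIONAL at the genuine-mod-`ε` producer** `genuineOfModel S C ε hΔ hq`
(abc-iut-L6-t13): its `O^⊳`/`O^×`/`O^{×μ}` sides and `G`-actions ARE those of `genuineOfModelIsm` (definitionally —
only the `Ism` datum differs), and the strong form's conclusion does not mention `Ism`, so the theorem transfers
verbatim. [claim: Mochizuki2012, status: disputed] (IUTchII §3 Prop 3.4 (ii), kurims pp.92-93) -/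
theorem prop34iiStrong_genuineOfModel (G : IsoClass S.Gk) :
    ∃ ψ : MulAut ((genuineOfModel S C ε hΔ hq).Oxmu G),
      (∀ (g : G.G) (x : (genuineOfModel S C ε hΔ hq).Oxmu G),
          ψ ((genuineOfModel S C ε hΔ hq).actOxmu G g x) = (genuineOfModel S C ε hΔ hq).actOxmu G g (ψ x)) ∧
      (∃ p : PairAut G ((genuineOfModel S C ε hΔ hq).Ounits G) ((genuineOfModel S C ε hΔ hq).actOunits G),
          PairAut.forget p = 1 ∧
          ∀ x : (genuineOfModel S C ε hΔ hq).Ounits G,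
            (QuotientGroup.mk (p.1.2 x) : (genuineOfModel S C ε hΔ hq).Oxmu G) = ψ (QuotientGroup.mk x)) ∧
      ∀ q : PairAut G ((genuineOfModel S C ε hΔ hq).Otri G) ((genuineOfModel S C ε hΔ hq).actOtri G),
          ∃ x : (genuineOfModel S C ε hΔ hq).Ounits G,
            (QuotientGroup.mk (Units.map q.1.2.toMonoidHom x) : (genuineOfModel S C ε hΔ hq).Oxmu G) ≠
              ψ (QuotientGroup.mk x) :=
  prop34iiStrong_genuineOfModelIsm S C ε hΔ hq G

end AbsTopMonoids

end Literature.IUT.HodgeArakelov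

end
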